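import Literature.Geometry.Lorentzian.ParametricAnnulusGluingCore
import Literature.Geometry.Lorentzian.CoordAdjointLinear
import Mathlib.Analysis.Normed.Module.Connected
import HarnessLib

/-!
# Jets of Killing initial data: linear structure, uniqueness from jet rigidity, gluing

Topic `Literature/Geometry/Lorentzian`. Everything here is PROVED; no definition, no statement of
`Prop` type is introduced (the jet rigidity `(J)` below is a HYPOTHESIS, spelled out in place).

Infrastructure for the KID exhaustion of an annulus (`ParametricAnnulusGluingKIDExhaustion.lean`),
which reduces the hypothesis `(K)` of
`ChruscielDelay_parametricAnnulusGluing_of_kidExhaustion_of_compactCore`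
(`ParametricAnnulusGluingCore.lean`) to the standard rigidity property of Killing initial data:

* `(J)` **jet rigidity** (hypothesis): on a connected open set `V ⊆ E3` carrying smooth Riemannian
  coordinate vacuum data, a smooth KID `(N, Y)` (solution of `DH*_γ N + DM*ˢ_γ Y = 0`,
  `DH*_κ N + DM*ˢ_κ Y = 0` on `V`) whose one-jet `(N, dN, Y, DY)` vanishes at one point of `V`
  vanishes on `V` (Moncrief 1975, §III: KIDs are the Cauchy data `(2N ν + Y)` of the Killing fields
  of the vacuum development, whose one-jet at the point is that of `(N, Y)`; a Killing field with
  vanishing one-jet at a point of a connected manifold vanishes — in the tree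
  `IsKillingField.eq_zero_of_oneJet_eq_zero`; equivalently, the KID system prolongs to a closed
  first-order linear system for `(N, ∇N, Y, ∇Y)`, Beig–Chruściel 1997, §2).

Contents:

* `isPreconnected_coordAnnulus` — the open annuli `{a < ‖z‖ < b}`, `0 < a`, of `E3` are
  preconnected;
* `MetricCoord.isMetricOn_of_pos` — smooth symmetric positive definite coefficients on an open set
  are `MetricCoord.IsMetricOn`;
* `MetricCoord.exists_kidJetSubmodule` — the jets at `z₀ ∈ V` of the smooth KIDs on an open `V`
  form a linear subspace of the jet space `ℝ × (E3 →L ℝ) × E3 × (E3 →L E3)` (linearity of the KID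
  equations, `CoordAdjointLinear.lean`);
* `kid_eq_of_kidJetRigidity` — under `(J)`, two smooth KIDs on a connected open `V` with the same
  one-jet at a point agree on `V`;
* `exists_glued_kid` — compatible KIDs on an increasing sequence of open sets glue (locality of the
  KID equations, `CoordConstraintCongr.lean`).

## References

* V. Moncrief, J. Math. Phys. 16 (1975) 493–498, §III. [Moncrief1975]
* R. Beig, P. T. Chruściel, *Killing initial data*, Class. Quantum Grav. 14 (1997) A83–A92, §2.
* P. T. Chruściel, E. Delay, Mém. Soc. Math. Fr. 94 (2003), §2 and §8.6. [ChruscielDelay2003]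
-/

noncomputable section

set_option maxSynthPendingDepth 3

open Set Function Filter TopologicalSpace Module Metric
open scoped ContDiff Topology

namespace Literature.Geometry.Lorentzian

/-! ### The open annuli of `E3` are connected -/

/-- The open annulus `{a < ‖z‖ < b}` of `E3` (`0 < a`) is preconnected: it is the image of
`sphere × (a, b)` under `(u, r) ↦ r • u`, and the unit sphere of `E3` is preconnected (a copy of
`isPreconnected_openAnnulus` of `MassCapacityRigidityHarmonic.lean`, to keep the import cone
small). [folklore] -/
theorem isPreconnected_coordAnnulus {a b : ℝ} (ha : 0 < a) :
    IsPreconnected {z : E3 | a < ‖z‖ ∧ ‖z‖ < b} := by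
  have himage : {z : E3 | a < ‖z‖ ∧ ‖z‖ < b} =
      (fun p : E3 × ℝ ↦ p.2 • p.1) '' (sphere (0 : E3) 1 ×ˢ Ioo a b) := by
    ext x
    simp only [mem_setOf_eq, mem_image, mem_prod, mem_sphere_zero_iff_norm, mem_Ioo, Prod.exists]
    constructor
    · rintro ⟨ha', hb⟩
      have hx0 : 0 < ‖x‖ := ha.trans ha'
      refine ⟨‖x‖⁻¹ • x, ‖x‖, ⟨?_, ha', hb⟩, ?_⟩
      · rw [norm_smul, norm_inv, norm_norm, inv_mul_cancel₀ hx0.ne']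
      · rw [smul_smul, mul_inv_cancel₀ hx0.ne', one_smul]
    · rintro ⟨y, r, ⟨hy, har, hrb⟩, rfl⟩
      have hr : 0 < r := ha.trans har
      rw [norm_smul, Real.norm_of_nonneg hr.le, hy, mul_one]
      exact ⟨har, hrb⟩
  rw [himage]
  have hE : 1 < Module.rank ℝ E3 :=
    Module.one_lt_rank_of_one_lt_finrank (by rw [finrank_euclideanSpace_fin]; norm_num)
  exact ((isPreconnected_sphere hE 0 1).prod isPreconnected_Ioo).image _
    (continuous_snd.smul continuous_fst).continuousOn

/-- Smooth positive definite symmetric coordinate metric components on an open set are metric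
components in the sense of `MetricCoord.IsMetricOn` (positive definite ⇒ nondegenerate ⇒
invertible, `isInvertible_of_nondegenerate`). [cite: ONeill1983, Ch. 3, Def. 3.1] -/
theorem MetricCoord.isMetricOn_of_pos {V : Set E3} {G : E3 → E3 →L[ℝ] E3 →L[ℝ] ℝ}
    (hV : IsOpen V) (hGs : ContDiffOn ℝ ∞ G V) (hsym : ∀ z ∈ V, ∀ v w : E3, G z v w = G z w v)
    (hpos : ∀ z ∈ V, ∀ v : E3, v ≠ 0 → 0 < G z v v) : MetricCoord.IsMetricOn G V := by
  refine ⟨hV, hGs, hsym, fun z hz ↦ MetricCoord.isInvertible_of_nondegenerate fun v hv ↦ ?_⟩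
  by_contra hv0
  have h := hpos z hz v hv0
  rw [hv v] at h
  exact lt_irrefl _ h

/-! ### Jets of KIDs form a subspace -/

/-- **The jets at a point of the smooth KIDs on an open set form a linear subspace** of the jet
space `ℝ × (E3 →L ℝ) × E3 × (E3 →L E3)`: the KID equations are linear in `(N, Y)`
(`MetricCoord.kid_add`, `kid_smul`, `kid_zero`), and so is the one-jet `(N z₀, dN_{z₀}, Y z₀, DY_{z₀})`.
Moncrief 1975, §III (the KIDs form a vector space). [cite: Moncrief1975, §III] -/
theorem MetricCoord.exists_kidJetSubmodule {V : Set E3} {G K : E3 → E3 →L[ℝ] E3 →L[ℝ] ℝ}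
    (hG : MetricCoord.IsMetricOn G V) (hK : ContDiffOn ℝ ∞ K V) {z₀ : E3} (hz₀ : z₀ ∈ V) :
    ∃ W : Submodule ℝ (ℝ × (E3 →L[ℝ] ℝ) × E3 × (E3 →L[ℝ] E3)),
      ∀ w, w ∈ W ↔ ∃ (N : E3 → ℝ) (Y : E3 → E3), ContDiffOn ℝ ∞ N V ∧ ContDiffOn ℝ ∞ Y V ∧
        (∀ z ∈ V, MetricCoord.adjHamG G K N z + MetricCoord.adjMomGS G K Y z = 0 ∧
          MetricCoord.adjHamK G K N z + MetricCoord.adjMomKS G Y z = 0) ∧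
        (N z₀, fderiv ℝ N z₀, Y z₀, fderiv ℝ Y z₀) = w := by
  -- the differentiability side conditions of the linearity lemmas, at the points of `V`
  have hdiff : ∀ {N : E3 → ℝ} {Y : E3 → E3}, ContDiffOn ℝ ∞ N V → ContDiffOn ℝ ∞ Y V →
      ∀ z ∈ V, ContDiffAt ℝ 2 N z ∧ DifferentiableAt ℝ Y z ∧
        DifferentiableAt ℝ (fun y ↦ MetricCoord.sharpAt G y (K y (Y y))) z := by
    intro N Y hN hY z hz
    have hn : V ∈ 𝓝 z := hG.isOpen.mem_nhds hz
    have hN2 : ContDiffAt ℝ 2 N z := ((hN z hz).contDiffAt hn).of_le (by norm_cast)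
    have hYd : DifferentiableAt ℝ Y z := ((hY z hz).contDiffAt hn).differentiableAt (by simp)
    have hKd : DifferentiableAt ℝ K z := ((hK z hz).contDiffAt hn).differentiableAt (by simp)
    exact ⟨hN2, hYd, (hG.differentiableAt_sharpAt hz).clm_apply (hKd.clm_apply hYd)⟩
  refine
    ⟨{carrier := {w | ∃ (N : E3 → ℝ) (Y : E3 → E3), ContDiffOn ℝ ∞ N V ∧ ContDiffOn ℝ ∞ Y V ∧
          (∀ z ∈ V, MetricCoord.adjHamG G K N z + MetricCoord.adjMomGS G K Y z = 0 ∧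
            MetricCoord.adjHamK G K N z + MetricCoord.adjMomKS G Y z = 0) ∧
          (N z₀, fderiv ℝ N z₀, Y z₀, fderiv ℝ Y z₀) = w}
      add_mem' := ?_
      zero_mem' := ?_
      smul_mem' := ?_ }, fun w ↦ Iff.rfl⟩
  · rintro _ _ ⟨N₁, Y₁, hN₁, hY₁, h₁, rfl⟩ ⟨N₂, Y₂, hN₂, hY₂, h₂, rfl⟩
    refine ⟨fun y ↦ N₁ y + N₂ y, fun y ↦ Y₁ y + Y₂ y, hN₁.add hN₂, hY₁.add hY₂,
      fun z hz ↦ ?_, ?_⟩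
    · obtain ⟨a₁, b₁, c₁⟩ := hdiff hN₁ hY₁ z hz
      obtain ⟨a₂, b₂, c₂⟩ := hdiff hN₂ hY₂ z hz
      exact MetricCoord.kid_add a₁ a₂ b₁ b₂ c₁ c₂ (h₁ z hz) (h₂ z hz)
    · obtain ⟨a₁, b₁, -⟩ := hdiff hN₁ hY₁ z₀ hz₀
      obtain ⟨a₂, b₂, -⟩ := hdiff hN₂ hY₂ z₀ hz₀
      rw [Prod.mk_add_mk, Prod.mk_add_mk, Prod.mk_add_mk,
        fderiv_fun_add (a₁.differentiableAt (by simp)) (a₂.differentiableAt (by simp)),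
        fderiv_fun_add b₁ b₂]
  · refine ⟨fun _ ↦ 0, fun _ ↦ 0, contDiffOn_const, contDiffOn_const,
      fun z _ ↦ MetricCoord.kid_zero, ?_⟩
    simp only [fderiv_fun_const, Pi.zero_apply, Prod.mk_zero_zero]
  · rintro c _ ⟨N, Y, hN, hY, h, rfl⟩
    refine ⟨fun y ↦ c * N y, fun y ↦ c • Y y, contDiffOn_const.mul hN, hY.const_smul c,
      fun z hz ↦ ?_, ?_⟩
    · obtain ⟨a, b, d⟩ := hdiff hN hY z hz
      exact MetricCoord.kid_smul a b d c (h z hz)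
    · obtain ⟨a, b, -⟩ := hdiff hN hY z₀ hz₀
      rw [Prod.smul_mk, Prod.smul_mk, Prod.smul_mk, smul_eq_mul,
        fderiv_const_mul (a.differentiableAt (by simp)) c, fderiv_fun_const_smul b c]

/-! ### Uniqueness of KIDs with a given jet, from jet rigidity -/

/-- **Under jet rigidity `(J)`, two smooth KIDs with the same one-jet at a point of a connected open
set agree on it** (apply `(J)` to their difference, a KID by linearity). [cite: Moncrief1975, §III] -/
theorem kid_eq_of_kidJetRigidity {ι : Type} [Fintype ι] (b₀ : Basis ι ℝ E3)
    (hJ : ∀ (V : Set E3), IsOpen V → IsConnected V →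
      ∀ (G K : E3 → E3 →L[ℝ] E3 →L[ℝ] ℝ), ContDiffOn ℝ ∞ G V → ContDiffOn ℝ ∞ K V →
        (∀ z ∈ V, ∀ v w : E3, G z v w = G z w v ∧ K z v w = K z w v) →
        (∀ z ∈ V, ∀ v : E3, v ≠ 0 → 0 < G z v v) →
        (∀ z ∈ V, MetricCoord.hamAt G K z = 0 ∧ ∀ Z : E3, MetricCoord.momFn b₀ G K z Z = 0) →
        ∀ (N : E3 → ℝ) (Y : E3 → E3), ContDiffOn ℝ ∞ N V → ContDiffOn ℝ ∞ Y V →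
          (∀ z ∈ V, MetricCoord.adjHamG G K N z + MetricCoord.adjMomGS G K Y z = 0 ∧
            MetricCoord.adjHamK G K N z + MetricCoord.adjMomKS G Y z = 0) →
          ∀ z₀ ∈ V, N z₀ = 0 → fderiv ℝ N z₀ = 0 → Y z₀ = 0 → fderiv ℝ Y z₀ = 0 →
            ∀ z ∈ V, N z = 0 ∧ Y z = 0)
    {V : Set E3} (hVo : IsOpen V) (hVc : IsConnected V) {G K : E3 → E3 →L[ℝ] E3 →L[ℝ] ℝ}
    (hGs : ContDiffOn ℝ ∞ G V) (hKs : ContDiffOn ℝ ∞ K V)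
    (hsym : ∀ z ∈ V, ∀ v w : E3, G z v w = G z w v ∧ K z v w = K z w v)
    (hpos : ∀ z ∈ V, ∀ v : E3, v ≠ 0 → 0 < G z v v)
    (hcv : ∀ z ∈ V, MetricCoord.hamAt G K z = 0 ∧ ∀ Z : E3, MetricCoord.momFn b₀ G K z Z = 0)
    {N₁ N₂ : E3 → ℝ} {Y₁ Y₂ : E3 → E3} (hN₁ : ContDiffOn ℝ ∞ N₁ V) (hN₂ : ContDiffOn ℝ ∞ N₂ V)
    (hY₁ : ContDiffOn ℝ ∞ Y₁ V) (hY₂ : ContDiffOn ℝ ∞ Y₂ V)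
    (h₁ : ∀ z ∈ V, MetricCoord.adjHamG G K N₁ z + MetricCoord.adjMomGS G K Y₁ z = 0 ∧
      MetricCoord.adjHamK G K N₁ z + MetricCoord.adjMomKS G Y₁ z = 0)
    (h₂ : ∀ z ∈ V, MetricCoord.adjHamG G K N₂ z + MetricCoord.adjMomGS G K Y₂ z = 0 ∧
      MetricCoord.adjHamK G K N₂ z + MetricCoord.adjMomKS G Y₂ z = 0)
    {z₀ : E3} (hz₀ : z₀ ∈ V) (hjN : N₁ z₀ = N₂ z₀) (hjdN : fderiv ℝ N₁ z₀ = fderiv ℝ N₂ z₀)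
    (hjY : Y₁ z₀ = Y₂ z₀) (hjDY : fderiv ℝ Y₁ z₀ = fderiv ℝ Y₂ z₀) :
    ∀ z ∈ V, N₁ z = N₂ z ∧ Y₁ z = Y₂ z := by
  have hG : MetricCoord.IsMetricOn G V :=
    MetricCoord.isMetricOn_of_pos hVo hGs (fun z hz v w ↦ (hsym z hz v w).1) hpos
  have hdiff : ∀ {N : E3 → ℝ} {Y : E3 → E3}, ContDiffOn ℝ ∞ N V → ContDiffOn ℝ ∞ Y V →
      ∀ z ∈ V, ContDiffAt ℝ 2 N z ∧ DifferentiableAt ℝ Y z ∧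
        DifferentiableAt ℝ (fun y ↦ MetricCoord.sharpAt G y (K y (Y y))) z := by
    intro N Y hN hY z hz
    have hn : V ∈ 𝓝 z := hVo.mem_nhds hz
    have hN2 : ContDiffAt ℝ 2 N z := ((hN z hz).contDiffAt hn).of_le (by norm_cast)
    have hYd : DifferentiableAt ℝ Y z := ((hY z hz).contDiffAt hn).differentiableAt (by simp)
    have hKd : DifferentiableAt ℝ K z := ((hKs z hz).contDiffAt hn).differentiableAt (by simp)
    exact ⟨hN2, hYd, (hG.differentiableAt_sharpAt hz).clm_apply (hKd.clm_apply hYd)⟩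
  -- the difference `(N₁ − N₂, Y₁ − Y₂)` is a smooth KID with vanishing one-jet at `z₀`
  set D : E3 → ℝ := fun y ↦ N₁ y + (-1) * N₂ y with hD
  set DY : E3 → E3 := fun y ↦ Y₁ y + (-1 : ℝ) • Y₂ y with hDY
  have hN₂' : ContDiffOn ℝ ∞ (fun y ↦ (-1) * N₂ y) V := contDiffOn_const.mul hN₂
  have hY₂' : ContDiffOn ℝ ∞ (fun y ↦ (-1 : ℝ) • Y₂ y) V := hY₂.const_smul (-1 : ℝ)
  have hDs : ContDiffOn ℝ ∞ D V := hN₁.add hN₂'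
  have hDYs : ContDiffOn ℝ ∞ DY V := hY₁.add hY₂'
  have hDeq : ∀ z ∈ V, MetricCoord.adjHamG G K D z + MetricCoord.adjMomGS G K DY z = 0 ∧
      MetricCoord.adjHamK G K D z + MetricCoord.adjMomKS G DY z = 0 := by
    intro z hz
    obtain ⟨a₁, b₁, c₁⟩ := hdiff hN₁ hY₁ z hz
    obtain ⟨a₂, b₂, c₂⟩ := hdiff hN₂ hY₂ z hz
    obtain ⟨a₃, b₃, c₃⟩ := hdiff hN₂' hY₂' z hz
    exact MetricCoord.kid_add a₁ a₃ b₁ b₃ c₁ c₃ (h₁ z hz) (MetricCoord.kid_smul a₂ b₂ c₂ (-1) (h₂ z hz))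
  obtain ⟨a₁, b₁, -⟩ := hdiff hN₁ hY₁ z₀ hz₀
  obtain ⟨a₂, b₂, -⟩ := hdiff hN₂ hY₂ z₀ hz₀
  have hD0 : D z₀ = 0 := by simp only [hD, hjN]; ring
  have hdD0 : fderiv ℝ D z₀ = 0 := by
    rw [hD, fderiv_fun_add (a₁.differentiableAt (by simp))
      ((a₂.differentiableAt (by simp)).const_mul _), fderiv_const_mul (a₂.differentiableAt (by simp)),
      hjdN]
    simp
  have hDY0 : DY z₀ = 0 := by simp only [hDY, hjY, neg_one_smul, add_neg_cancel]
  have hdDY0 : fderiv ℝ DY z₀ = 0 := by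
    rw [hDY, fderiv_fun_add b₁ (b₂.fun_const_smul (-1 : ℝ)), fderiv_fun_const_smul b₂, hjDY]
    simp
  have hzero := hJ V hVo hVc G K hGs hKs hsym hpos hcv D DY hDs hDYs hDeq z₀ hz₀ hD0 hdD0 hDY0 hdDY0
  intro z hz
  obtain ⟨hN, hY⟩ := hzero z hz
  constructor
  · have h : N₁ z + (-1) * N₂ z = 0 := hN
    linarith
  · have h : Y₁ z + (-1 : ℝ) • Y₂ z = 0 := hY
    rwa [neg_one_smul, ← sub_eq_add_neg, sub_eq_zero] at h

/-! ### Gluing compatible KIDs over an increasing sequence of open sets -/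

/-- **Compatible KIDs on an increasing sequence of open sets glue.** Let `V₀ ⊆ V₁ ⊆ …` be open
sets of `E3` and, for `n ≥ n₁`, `(N_n, Y_n)` smooth KIDs of `(G, K)` on `V_n` such that
`(N_n, Y_n) = (N_m, Y_m)` on `V_m` for `n₁ ≤ m ≤ n`. Then there is a smooth KID `(N, Y)` on
`⋃ V_n` equal to `(N_m, Y_m)` on `V_m` for every `m ≥ n₁` (the KID equations are local,
`CoordConstraintCongr.lean`). [folklore] -/
theorem exists_glued_kid {G K : E3 → E3 →L[ℝ] E3 →L[ℝ] ℝ} (V : ℕ → Set E3)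
    (hVo : ∀ n, IsOpen (V n)) (hVm : Monotone V) (n₁ : ℕ) (Nf : ℕ → E3 → ℝ) (Yf : ℕ → E3 → E3)
    (hsm : ∀ n, n₁ ≤ n → ContDiffOn ℝ ∞ (Nf n) (V n) ∧ ContDiffOn ℝ ∞ (Yf n) (V n))
    (heq : ∀ n, n₁ ≤ n → ∀ z ∈ V n,
      MetricCoord.adjHamG G K (Nf n) z + MetricCoord.adjMomGS G K (Yf n) z = 0 ∧
        MetricCoord.adjHamK G K (Nf n) z + MetricCoord.adjMomKS G (Yf n) z = 0)
    (hcompat : ∀ m n, n₁ ≤ m → m ≤ n → ∀ z ∈ V m, Nf n z = Nf m z ∧ Yf n z = Yf m z) :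
    ∃ (Ng : E3 → ℝ) (Yg : E3 → E3),
      ContDiffOn ℝ ∞ Ng (⋃ n, V n) ∧ ContDiffOn ℝ ∞ Yg (⋃ n, V n) ∧
      (∀ z ∈ ⋃ n, V n, MetricCoord.adjHamG G K Ng z + MetricCoord.adjMomGS G K Yg z = 0 ∧
        MetricCoord.adjHamK G K Ng z + MetricCoord.adjMomKS G Yg z = 0) ∧
      (∀ m, n₁ ≤ m → ∀ z ∈ V m, Ng z = Nf m z ∧ Yg z = Yf m z) := by
  classical
  -- the index of a point: the first `V_n` containing it, pushed above `n₁`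
  let idx : E3 → ℕ := fun z ↦ if h : ∃ n, z ∈ V n then max n₁ (Nat.find h) else n₁
  have hidx₁ : ∀ z, n₁ ≤ idx z := by
    intro z
    by_cases h : ∃ n, z ∈ V n
    · simp only [idx, dif_pos h]
      exact le_max_left _ _
    · simp only [idx, dif_neg h]
      exact le_rfl
  have hidx₂ : ∀ z, (∃ n, z ∈ V n) → z ∈ V (idx z) := by
    intro z h
    simp only [idx, dif_pos h]
    exact hVm (le_max_right _ _) (Nat.find_spec h)
  -- agreement with `(N_m, Y_m)` on `V_m`, `m ≥ n₁`
  have hagree : ∀ m, n₁ ≤ m → ∀ z ∈ V m, Nf (idx z) z = Nf m z ∧ Yf (idx z) z = Yf m z := by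
    intro m hm z hz
    have hk := hidx₁ z
    have hzk : z ∈ V (idx z) := hidx₂ z ⟨m, hz⟩
    rcases le_total (idx z) m with hkm | hmk
    · obtain ⟨h1, h2⟩ := hcompat (idx z) m hk hkm z hzk
      exact ⟨h1.symm, h2.symm⟩
    · exact hcompat m (idx z) hm hmk z hz
  have hev : ∀ m, n₁ ≤ m → ∀ z ∈ V m,
      (fun z ↦ Nf (idx z) z) =ᶠ[𝓝 z] Nf m ∧ (fun z ↦ Yf (idx z) z) =ᶠ[𝓝 z] Yf m := by
    intro m hm z hz
    constructor
    · filter_upwards [(hVo m).mem_nhds hz] with y hy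
      exact (hagree m hm y hy).1
    · filter_upwards [(hVo m).mem_nhds hz] with y hy
      exact (hagree m hm y hy).2
  -- every point of the union lies in some `V_m` with `m ≥ n₁`
  have hmem : ∀ z ∈ ⋃ n, V n, ∃ m, n₁ ≤ m ∧ z ∈ V m := by
    intro z hz
    obtain ⟨n, hn⟩ := mem_iUnion.1 hz
    exact ⟨max n n₁, le_max_right _ _, hVm (le_max_left _ _) hn⟩
  refine ⟨fun z ↦ Nf (idx z) z, fun z ↦ Yf (idx z) z, ?_, ?_, ?_, hagree⟩
  · intro z hz
    obtain ⟨m, hm, hzm⟩ := hmem z hz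
    exact ((((hsm m hm).1 z hzm).contDiffAt ((hVo m).mem_nhds hzm)).congr_of_eventuallyEq
      (hev m hm z hzm).1).contDiffWithinAt
  · intro z hz
    obtain ⟨m, hm, hzm⟩ := hmem z hz
    exact ((((hsm m hm).2 z hzm).contDiffAt ((hVo m).mem_nhds hzm)).congr_of_eventuallyEq
      (hev m hm z hzm).2).contDiffWithinAt
  · intro z hz
    obtain ⟨m, hm, hzm⟩ := hmem z hz
    obtain ⟨hN, hY⟩ := hev m hm z hzm
    rw [MetricCoord.adjHamG_congr_of_eventuallyEq EventuallyEq.rfl EventuallyEq.rfl hN,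
      MetricCoord.adjMomGS_congr_of_eventuallyEq EventuallyEq.rfl EventuallyEq.rfl hY,
      MetricCoord.adjHamK_congr_of_eventuallyEq EventuallyEq.rfl EventuallyEq.rfl hN,
      MetricCoord.adjMomKS_congr_of_eventuallyEq EventuallyEq.rfl hY]
    exact heq m hm z hzm

end Literature.Geometry.Lorentzian

end
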